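import Summits.AtomisticToContinuum.Crystallization.Theorems.FrustratedLawDichotomyHalfSpaceEnergyColumn
import Literature.Analysis.Calculus.ArchimedesProjection

/-!
# FrustratedLawDichotomy · crux `AperiodicFrustratedLawGap` (stmt-AtomisticToContinuum-27623) — the half-space columns with the SHARP CAP count
# (hdef side, row class H, class-D side; lever «HS-stair» of critic r1752 (C) realised exactly: cap volume instead of the cylinder majorant; decomp-a2c, prover hand 1, gen 51)

`…HalfSpaceColumn.card_le_of_separated_cap` counts the `δ/2`-balls of a separated half-space configuration inside a CYLINDER, which over-counts the
spherical cap by `3(ρ₂ + a₀)/(2ρ₂ + a₀) ∈ (3/2, 2]` — exactly where the `r⁻ᵖ` weight concentrates — so the proved half-space columns `TH`, `SH6` sit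
`≈ 1.8–1.9×` above the cap-sharp ones (desk FARCOL-HALO §8/§13; the class-D-side inner radius 7 of record then holds with margin `×1.09` only).
This file replaces the cylinder by the EXACT CAP VOLUME via Archimedes' slicing (`Literature.Analysis.Calculus.integral_ball_comp_inner`:
`∫_{B_ρ} g⟪y,e⟫ dy = ∫_{−ρ}^{ρ} π(ρ² − t²) g(t) dt` for continuous `g`), applied to a continuous ramp majorant of the cap's indicator and a limit:

* `volumeReal_cap_le` — `vol {x | a < ⟪x, e⟫, ‖x‖ < ρ} ≤ (π/3)(ρ − a)²(2ρ + a)` (`‖e‖ = 1`, `0 ≤ a ≤ ρ`, `0 < ρ`);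
* `card_le_of_separated_cap_sharp` — `#t ≤ (2/δ³)(D − d + δ)²(2D + d + δ/2)` for a finite `δ`-separated `t ⊆ {⟪a, e⟫ ≥ d, ‖a‖ ≤ D}` (`δ/2 ≤ d ≤ D`);
* ★ `sum_rpow_neg_le_of_separated_halfspace_sharp` — the half-space inverse-power column with the cap-sharp cubic
  (`c₃ = 4/δ³`, `c₂ = (2/δ³)(9δ/2 − 3d)`, `c₁ = (6/δ²)(δ − d)`, `c₀ = (2/δ³)(δ − d)²(d + δ/2)` in `…HalfSpaceColumn.sum_rpow_neg_le_of_card_filter_le`);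
* `sum_norm_force_le_of_separated_halfspace_sharp_sevenTenths`, `sum_inv_pow_six_le_of_separated_halfspace_sharp_sevenTenths` — the `δ = 7/10`
  force (`p = 7, 13`) and energy (`p = 6`) columns `TH♯(d)`, `SH6♯(d)`, with literals `TH♯(7) ≤ 23/20000`, `SH6♯(7) ≤ 3/250`
  (`TH(7) = 2.08·10⁻³ → 1.13·10⁻³`, `SH6(7) = 2.15·10⁻² → 1.16·10⁻²`).

DEF-FREE; imports the tree's `…HalfSpaceEnergyColumn` and `Literature…ArchimedesProjection`; 0 sorry.  [folklore]
-/

noncomputable section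

namespace Summit.AtomisticToContinuum.Crystallization.Theorems.FrustratedLawDichotomyHalfSpaceCapSharp

open scoped BigOperators RealInnerProductSpace ENNReal Topology
open MeasureTheory Metric Set Filter
open Summit.AtomisticToContinuum.Crystallization.Theorems.FrustratedLawDichotomyFarForceColumn (norm_force_term_le)
open Summit.AtomisticToContinuum.Crystallization.Theorems.FrustratedLawDichotomyHalfSpaceColumn
  (sum_rpow_neg_le_of_card_filter_le rpow_natCast_sub_natCast)

/-! ## §1. The volume of a spherical cap (upper bound, exact value) -/

/-- **CAP VOLUME.**  For a unit vector `e` of `ℝ³`, `0 ≤ a ≤ ρ`, `0 < ρ`: `vol {x | a < ⟪x, e⟫ ∧ ‖x‖ < ρ} ≤ (π/3)(ρ − a)²(2ρ + a)`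
(Archimedes' slicing of the ball against a continuous ramp majorant of the cap's indicator, then the ramp width `ε → 0`). [folklore] -/
theorem volumeReal_cap_le (e : EuclideanSpace ℝ (Fin 3)) (he : ‖e‖ = 1) {a ρ : ℝ} (ha : 0 ≤ a) (haρ : a ≤ ρ) (hρ : 0 < ρ) :
    volume.real {x : EuclideanSpace ℝ (Fin 3) | a < ⟪x, e⟫ ∧ ‖x‖ < ρ} ≤ Real.pi / 3 * (ρ - a) ^ 2 * (2 * ρ + a) := by
  set C : Set (EuclideanSpace ℝ (Fin 3)) := {x | a < ⟪x, e⟫ ∧ ‖x‖ < ρ} with hC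
  set B : Set (EuclideanSpace ℝ (Fin 3)) := ball 0 ρ with hB
  have hCB : C ⊆ B := fun x hx => by rw [hB, mem_ball_zero_iff]; exact hx.2
  have hinner : Continuous fun x : EuclideanSpace ℝ (Fin 3) => ⟪x, e⟫ := continuous_id.inner continuous_const
  have hCmeas : MeasurableSet C := by
    have h1 : IsOpen {x : EuclideanSpace ℝ (Fin 3) | a < ⟪x, e⟫} := isOpen_lt continuous_const hinner
    have h2 : IsOpen {x : EuclideanSpace ℝ (Fin 3) | ‖x‖ < ρ} := isOpen_lt continuous_norm continuous_const
    exact (h1.inter h2).measurableSet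
  have hBfin : volume B ≠ ⊤ := measure_ball_lt_top.ne
  -- the bound for every ramp width `ε ∈ (0, ρ]`
  have key : ∀ ε : ℝ, 0 < ε → ε ≤ ρ → volume.real C ≤ Real.pi / 3 * (ρ - (a - ε)) ^ 2 * (2 * ρ + (a - ε)) := by
    intro ε hε hερ
    set g : ℝ → ℝ := fun t => min 1 (max 0 ((t - a) / ε + 1)) with hg
    have hgc : Continuous g := by
      rw [hg]
      exact continuous_const.min (continuous_const.max ((( continuous_id.sub continuous_const).div_const ε).add continuous_const))
    have hg0 : ∀ t, 0 ≤ g t := fun t => le_min zero_le_one (le_max_left _ _)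
    have hg1 : ∀ t, g t ≤ 1 := fun t => min_le_left _ _
    have hg_one : ∀ t, a < t → g t = 1 := fun t ht => by
      show min 1 (max 0 ((t - a) / ε + 1)) = 1
      have : 1 ≤ max 0 ((t - a) / ε + 1) := le_max_of_le_right (by
        have : 0 ≤ (t - a) / ε := div_nonneg (by linarith) hε.le
        linarith)
      exact min_eq_left this
    have hg_zero : ∀ t, t ≤ a - ε → g t = 0 := fun t ht => by
      show min 1 (max 0 ((t - a) / ε + 1)) = 0
      have h1 : (t - a) / ε + 1 ≤ 0 := by
        rw [div_add_one hε.ne', div_nonpos_iff]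
        exact Or.inr ⟨by linarith, hε.le⟩
      rw [max_eq_left h1, min_eq_right zero_le_one]
    -- (1) the volume as an integral of the indicator over the ball
    have h1 : volume.real C = ∫ x in B, C.indicator (1 : EuclideanSpace ℝ (Fin 3) → ℝ) x := by
      rw [integral_indicator_one hCmeas, measureReal_restrict_apply hCmeas, Set.inter_eq_left.2 hCB]
    -- (2) indicator ≤ ramp ∘ inner on the ball
    have hint_ind : IntegrableOn (fun x => C.indicator (1 : EuclideanSpace ℝ (Fin 3) → ℝ) x) B :=
      Measure.integrableOn_of_bounded (M := 1) hBfin (aestronglyMeasurable_const.indicator hCmeas)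
        (Eventually.of_forall fun x => by
          by_cases hx : x ∈ C
          · rw [Set.indicator_of_mem hx, Pi.one_apply]; simp
          · rw [Set.indicator_of_notMem hx]; simp)
    have hint_g : IntegrableOn (fun x : EuclideanSpace ℝ (Fin 3) => g ⟪x, e⟫) B :=
      Measure.integrableOn_of_bounded (M := 1) hBfin (hgc.comp hinner).aestronglyMeasurable
        (Eventually.of_forall fun x => by
          rw [Real.norm_eq_abs, abs_of_nonneg (hg0 _)]; exact hg1 _)
    have h2 : ∫ x in B, C.indicator (1 : EuclideanSpace ℝ (Fin 3) → ℝ) x ≤ ∫ x in B, g ⟪x, e⟫ := by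
      refine setIntegral_mono_on hint_ind hint_g measurableSet_ball fun x _ => ?_
      by_cases hx : x ∈ C
      · rw [Set.indicator_of_mem hx, Pi.one_apply, hg_one _ hx.1]
      · rw [Set.indicator_of_notMem hx]; exact hg0 _
    -- (3) Archimedes' slicing
    have h3 : ∫ x in B, g ⟪x, e⟫ = ∫ t in (-ρ)..ρ, (Real.pi * (ρ ^ 2 - t ^ 2)) • g t :=
      Literature.Analysis.Calculus.integral_ball_comp_inner hgc he hρ.le
    -- (4) the one-dimensional integral: zero below `a − ε`, at most `π(ρ² − t²)` above
    set f : ℝ → ℝ := fun t => (Real.pi * (ρ ^ 2 - t ^ 2)) • g t with hf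
    have hfc : Continuous f := by
      rw [hf]
      exact ((continuous_const.mul (continuous_const.sub (continuous_id.pow 2))).smul hgc)
    have hab : -ρ ≤ a - ε := by linarith
    have hsplit : ∫ t in (-ρ)..ρ, f t = (∫ t in (-ρ)..(a - ε), f t) + ∫ t in (a - ε)..ρ, f t :=
      (intervalIntegral.integral_add_adjacent_intervals (hfc.intervalIntegrable _ _) (hfc.intervalIntegrable _ _)).symm
    have hlow : ∫ t in (-ρ)..(a - ε), f t = 0 := by
      have : ∫ t in (-ρ)..(a - ε), f t = ∫ t in (-ρ)..(a - ε), (0:ℝ) := by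
        refine intervalIntegral.integral_congr fun t ht => ?_
        rw [Set.uIcc_of_le hab, Set.mem_Icc] at ht
        simp only [hf, hg_zero t ht.2, smul_eq_mul, mul_zero]
      rw [this, intervalIntegral.integral_const, smul_zero]
    have hup : ∫ t in (a - ε)..ρ, f t ≤ ∫ t in (a - ε)..ρ, Real.pi * (ρ ^ 2 - t ^ 2) := by
      have hpc : Continuous fun t : ℝ => Real.pi * (ρ ^ 2 - t ^ 2) := continuous_const.mul (continuous_const.sub (continuous_id.pow 2))
      refine intervalIntegral.integral_mono_on (by linarith) (hfc.intervalIntegrable _ _) (hpc.intervalIntegrable _ _) fun t ht => ?_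
      rw [Set.mem_Icc] at ht
      have hpos : 0 ≤ Real.pi * (ρ ^ 2 - t ^ 2) := by
        have : t ^ 2 ≤ ρ ^ 2 := by nlinarith
        exact mul_nonneg Real.pi_pos.le (by linarith)
      simp only [hf, smul_eq_mul]
      calc Real.pi * (ρ ^ 2 - t ^ 2) * g t ≤ Real.pi * (ρ ^ 2 - t ^ 2) * 1 := mul_le_mul_of_nonneg_left (hg1 t) hpos
        _ = Real.pi * (ρ ^ 2 - t ^ 2) := mul_one _
    have hval : ∫ t in (a - ε)..ρ, Real.pi * (ρ ^ 2 - t ^ 2) = Real.pi / 3 * (ρ - (a - ε)) ^ 2 * (2 * ρ + (a - ε)) := by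
      rw [intervalIntegral.integral_const_mul, intervalIntegral.integral_sub intervalIntegrable_const
        ((continuous_pow 2).intervalIntegrable _ _), intervalIntegral.integral_const, integral_pow]
      simp only [smul_eq_mul]
      push_cast
      ring
    calc volume.real C = ∫ x in B, C.indicator (1 : EuclideanSpace ℝ (Fin 3) → ℝ) x := h1
      _ ≤ ∫ x in B, g ⟪x, e⟫ := h2
      _ = ∫ t in (-ρ)..ρ, f t := h3
      _ = (∫ t in (-ρ)..(a - ε), f t) + ∫ t in (a - ε)..ρ, f t := hsplit
      _ ≤ 0 + ∫ t in (a - ε)..ρ, Real.pi * (ρ ^ 2 - t ^ 2) := by rw [hlow]; linarith [hup]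
      _ = Real.pi / 3 * (ρ - (a - ε)) ^ 2 * (2 * ρ + (a - ε)) := by rw [zero_add, hval]
  -- the limit `ε → 0⁺`
  have hlim : Tendsto (fun ε : ℝ => Real.pi / 3 * (ρ - (a - ε)) ^ 2 * (2 * ρ + (a - ε))) (𝓝[>] 0)
      (𝓝 (Real.pi / 3 * (ρ - (a - 0)) ^ 2 * (2 * ρ + (a - 0)))) := by
    have hc : Continuous fun ε : ℝ => Real.pi / 3 * (ρ - (a - ε)) ^ 2 * (2 * ρ + (a - ε)) := by fun_prop
    exact (hc.tendsto 0).mono_left nhdsWithin_le_nhds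
  have hev : ∀ᶠ ε in 𝓝[>] (0:ℝ), volume.real C ≤ Real.pi / 3 * (ρ - (a - ε)) ^ 2 * (2 * ρ + (a - ε)) := by
    filter_upwards [Ioo_mem_nhdsGT hρ] with ε hε
    exact key ε hε.1 hε.2.le
  have := ge_of_tendsto hlim hev
  simpa only [sub_zero] using this

/-! ## §2. Cap packing with the sharp volume -/

/-- **CAP PACKING, sharp.**  Let `e` be a unit vector, `0 < δ`, `δ/2 ≤ d ≤ D`, and `t` a finite `δ`-separated set with `d ≤ ⟪a, e⟫` and `‖a‖ ≤ D` for all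
`a ∈ t`.  Then `#t ≤ (2/δ³)(D − d + δ)²(2D + d + δ/2)`: the disjoint `δ/2`-balls lie in the cap `{⟪x,e⟫ > d − δ/2, ‖x‖ < D + δ/2}` of volume
`≤ (π/3)(D − d + δ)²(2(D + δ/2) + d − δ/2)`, each of volume `πδ³/6`. [folklore] -/
theorem card_le_of_separated_cap_sharp (t : Finset (EuclideanSpace ℝ (Fin 3))) (e : EuclideanSpace ℝ (Fin 3)) (he : ‖e‖ = 1)
    {δ d D : ℝ} (hδ : 0 < δ) (hd : δ / 2 ≤ d) (hdD : d ≤ D)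
    (hsep : ∀ a ∈ t, ∀ b ∈ t, a ≠ b → δ ≤ dist a b) (ht : ∀ a ∈ t, d ≤ ⟪a, e⟫ ∧ ‖a‖ ≤ D) :
    (t.card : ℝ) ≤ 2 / δ ^ 3 * (D - d + δ) ^ 2 * (2 * D + d + δ / 2) := by
  classical
  set a₀ : ℝ := d - δ / 2 with ha₀
  set ρ₂ : ℝ := D + δ / 2 with hρ₂
  have ha₀0 : 0 ≤ a₀ := by rw [ha₀]; linarith
  have haρ : a₀ ≤ ρ₂ := by rw [ha₀, hρ₂]; linarith
  have hρ₂0 : 0 < ρ₂ := by rw [hρ₂]; linarith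
  set C : Set (EuclideanSpace ℝ (Fin 3)) := {x | a₀ < ⟪x, e⟫ ∧ ‖x‖ < ρ₂} with hC
  have hCvol := volumeReal_cap_le e he ha₀0 haρ hρ₂0
  have hCfin : volume C ≠ ⊤ :=
    (measure_mono (fun x (hx : x ∈ C) => mem_ball_zero_iff.2 hx.2) |>.trans_lt (measure_ball_lt_top (x := (0 : EuclideanSpace ℝ (Fin 3))))).ne
  -- the disjoint small balls
  set A : Set (EuclideanSpace ℝ (Fin 3)) := ⋃ a ∈ t, ball a (δ / 2) with hA
  have hdisj : (t : Set (EuclideanSpace ℝ (Fin 3))).PairwiseDisjoint fun a => ball a (δ / 2) := by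
    intro a ha c hc hac
    apply ball_disjoint_ball
    have := hsep a ha c hc hac
    linarith
  have hAvol : volume A = (t.card : ℝ≥0∞) * (ENNReal.ofReal (δ / 2) ^ 3 * ENNReal.ofReal (Real.pi * 4 / 3)) := by
    rw [hA, measure_biUnion_finset hdisj fun a _ => measurableSet_ball]
    simp only [EuclideanSpace.volume_ball_fin_three, Finset.sum_const, nsmul_eq_mul]
  -- the balls lie in the cap
  have hsub : A ⊆ C := by
    rw [hA]
    refine iUnion₂_subset fun a ha x hx => ?_
    rw [mem_ball, dist_eq_norm] at hx
    obtain ⟨hae, haD⟩ := ht a ha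
    have hx0 : ⟪x, e⟫ = ⟪a, e⟫ + ⟪x - a, e⟫ := by rw [← inner_add_left, add_sub_cancel]
    have hcs : |⟪x - a, e⟫| ≤ ‖x - a‖ := by
      have := abs_real_inner_le_norm (x - a) e; rwa [he, mul_one] at this
    refine ⟨?_, ?_⟩
    · rw [hx0, ha₀]
      have := neg_abs_le ⟪x - a, e⟫
      linarith
    · have : ‖x‖ ≤ ‖a‖ + ‖x - a‖ := by
        have := norm_add_le a (x - a); rwa [add_sub_cancel] at this
      rw [hρ₂]; linarith
  -- compare volumes in the reals
  have hvol : (t.card : ℝ≥0∞) * (ENNReal.ofReal (δ / 2) ^ 3 * ENNReal.ofReal (Real.pi * 4 / 3)) ≤ volume C := by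
    rw [← hAvol]; exact measure_mono hsub
  have hreal := ENNReal.toReal_mono hCfin hvol
  rw [ENNReal.toReal_mul, ENNReal.toReal_mul, ENNReal.toReal_natCast, ← ENNReal.ofReal_pow (by positivity : (0:ℝ) ≤ δ / 2),
    ENNReal.toReal_ofReal (by positivity), ENNReal.toReal_ofReal (by positivity)] at hreal
  have hreal' : (t.card : ℝ) * ((δ / 2) ^ 3 * (Real.pi * 4 / 3)) ≤ Real.pi / 3 * (ρ₂ - a₀) ^ 2 * (2 * ρ₂ + a₀) :=
    hreal.trans hCvol
  have hπ : 0 < Real.pi := Real.pi_pos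
  have hδ3 : 0 < δ ^ 3 := pow_pos hδ 3
  have key : (t.card : ℝ) * δ ^ 3 ≤ 2 * ((ρ₂ - a₀) ^ 2 * (2 * ρ₂ + a₀)) := by
    have h1 : (t.card : ℝ) * ((δ / 2) ^ 3 * (Real.pi * 4 / 3)) = ((t.card : ℝ) * δ ^ 3) * (Real.pi / 6) := by ring
    have h2 : Real.pi / 3 * (ρ₂ - a₀) ^ 2 * (2 * ρ₂ + a₀) = (2 * ((ρ₂ - a₀) ^ 2 * (2 * ρ₂ + a₀))) * (Real.pi / 6) := by ring
    rw [h1, h2] at hreal'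
    exact le_of_mul_le_mul_right hreal' (by positivity)
  have e1 : ρ₂ - a₀ = D - d + δ := by rw [hρ₂, ha₀]; ring
  have e2 : 2 * ρ₂ + a₀ = 2 * D + d + δ / 2 := by rw [hρ₂, ha₀]; ring
  rw [e1, e2] at key
  rw [div_mul_eq_mul_div, div_mul_eq_mul_div, le_div_iff₀ hδ3]
  linarith

/-! ## §3. The half-space column with the sharp cap count -/

/-- ★ **HALF-SPACE INVERSE-POWER COLUMN, cap-sharp.**  Under the hypotheses of `…HalfSpaceColumn.sum_rpow_neg_le_of_separated_halfspace`,
`Σ_{a ∈ s} (dist a q)^{−p} ≤ p·(c₃ d^{3−p}/(p−3) + c₂ d^{2−p}/(p−2) + c₁ d^{1−p}/(p−1) + c₀ d^{−p}/p)` with the CAP coefficients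
`c₃ = 4/δ³`, `c₂ = (2/δ³)(9δ/2 − 3d)`, `c₁ = (6/δ²)(δ − d)`, `c₀ = (2/δ³)(δ − d)²(d + δ/2)`. [folklore] -/
theorem sum_rpow_neg_le_of_separated_halfspace_sharp (s : Finset (EuclideanSpace ℝ (Fin 3))) (q e : EuclideanSpace ℝ (Fin 3)) (he : ‖e‖ = 1)
    {δ d p : ℝ} (hδ : 0 < δ) (hd2 : δ / 2 ≤ d) (hd : 0 < d) (hp : 3 < p)
    (hsep : ∀ a ∈ s, ∀ b ∈ s, a ≠ b → δ ≤ dist a b) (hhalf : ∀ a ∈ s, d ≤ ⟪a - q, e⟫) :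
    ∑ a ∈ s, (dist a q) ^ (-p) ≤
      p * (4 / δ ^ 3 * d ^ (3 - p) / (p - 3) + 2 / δ ^ 3 * (9 * δ / 2 - 3 * d) * d ^ (2 - p) / (p - 2) +
        6 / δ ^ 2 * (δ - d) * d ^ (1 - p) / (p - 1) + 2 / δ ^ 3 * ((δ - d) ^ 2 * (d + δ / 2)) * d ^ (-p) / p) := by
  classical
  have hfar : ∀ a ∈ s, d ≤ dist a q := fun a ha => by
    rw [dist_eq_norm]
    have h1 := hhalf a ha
    have h2 : ⟪a - q, e⟫ ≤ ‖a - q‖ * ‖e‖ := real_inner_le_norm _ _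
    rw [he, mul_one] at h2
    linarith
  refine sum_rpow_neg_le_of_card_filter_le s q hd hp hfar fun t ht => ?_
  set F : Finset (EuclideanSpace ℝ (Fin 3)) := s.filter fun a => dist a q < t with hF
  set F' : Finset (EuclideanSpace ℝ (Fin 3)) := F.image fun a => a - q with hF'
  have hcard : F'.card = F.card := Finset.card_image_of_injective _ (sub_left_injective)
  have hsep' : ∀ a ∈ F', ∀ b ∈ F', a ≠ b → δ ≤ dist a b := by
    intro a ha b hb hab
    rw [hF', Finset.mem_image] at ha hb
    obtain ⟨a', ha', rfl⟩ := ha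
    obtain ⟨b', hb', rfl⟩ := hb
    rw [dist_eq_norm, sub_sub_sub_cancel_right, ← dist_eq_norm]
    exact hsep a' (Finset.mem_filter.1 ha').1 b' (Finset.mem_filter.1 hb').1 fun h => hab (by rw [h])
  have hF't : ∀ a ∈ F', d ≤ ⟪a, e⟫ ∧ ‖a‖ ≤ t := by
    intro a ha
    rw [hF', Finset.mem_image] at ha
    obtain ⟨a', ha', rfl⟩ := ha
    obtain ⟨ha's, ha't⟩ := Finset.mem_filter.1 ha'
    refine ⟨hhalf a' ha's, ?_⟩
    rw [← dist_eq_norm]; exact ha't.le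
  have h := card_le_of_separated_cap_sharp F' e he hδ hd2 ht.le hsep' hF't
  rw [hcard] at h
  refine h.trans (le_of_eq ?_)
  field_simp
  ring

/-! ## §4. The `δ = 7/10` force and energy columns, cap-sharp -/

/-- ★ **Cap-sharp half-space FORCE column at separation `7/10`** (`p = 7, 13`):
`Σ_{a ∈ s} ‖force‖ ≤ TH♯(d)` with `TH♯(d) = 7·Q₇(d) + 13·Q₁₃(d)`, `Q_p(d) = c₃ d^{3−p}/(p−3) + c₂ d^{2−p}/(p−2) + c₁ d^{1−p}/(p−1) + c₀ d^{−p}/p` and the cap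
coefficients at `δ = 7/10`: `c₃ = 4000/343`, `c₂ = (2000/343)(63/20 − 3d)`, `c₁ = (600/49)(7/10 − d)`, `c₀ = (2000/343)(7/10 − d)²(d + 7/20)`. [folklore] -/
theorem sum_norm_force_le_of_separated_halfspace_sharp_sevenTenths (s : Finset (EuclideanSpace ℝ (Fin 3)))
    (x e : EuclideanSpace ℝ (Fin 3)) (he : ‖e‖ = 1) {d : ℝ} (hd : 7 / 20 ≤ d)
    (hsep : ∀ a ∈ s, ∀ b ∈ s, a ≠ b → (7 : ℝ) / 10 ≤ dist a b) (hhalf : ∀ a ∈ s, d ≤ ⟪a - x, e⟫) :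
    ∑ a ∈ s, ‖((dist x a)⁻¹ ^ 8 - (dist x a)⁻¹ ^ 14) • (x - a)‖ ≤
      7 * (4000 / 343 * d⁻¹ ^ 4 / 4 + 2000 / 343 * (63 / 20 - 3 * d) * d⁻¹ ^ 5 / 5 + 600 / 49 * (7 / 10 - d) * d⁻¹ ^ 6 / 6 +
          2000 / 343 * ((7 / 10 - d) ^ 2 * (d + 7 / 20)) * d⁻¹ ^ 7 / 7) +
        13 * (4000 / 343 * d⁻¹ ^ 10 / 10 + 2000 / 343 * (63 / 20 - 3 * d) * d⁻¹ ^ 11 / 11 + 600 / 49 * (7 / 10 - d) * d⁻¹ ^ 12 / 12 +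
          2000 / 343 * ((7 / 10 - d) ^ 2 * (d + 7 / 20)) * d⁻¹ ^ 13 / 13) := by
  have hd0 : 0 < d := by linarith
  have h7 := sum_rpow_neg_le_of_separated_halfspace_sharp s x e he (p := 7) (by norm_num : (0:ℝ) < 7 / 10) (by linarith) hd0
    (by norm_num) hsep hhalf
  have h13 := sum_rpow_neg_le_of_separated_halfspace_sharp s x e he (p := 13) (by norm_num : (0:ℝ) < 7 / 10) (by linarith) hd0
    (by norm_num) hsep hhalf
  have hpos : ∀ a ∈ s, 0 < dist a x := fun a ha => hd0.trans_le (by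
    have := hhalf a ha; have h2 : ⟪a - x, e⟫ ≤ ‖a - x‖ * ‖e‖ := real_inner_le_norm _ _
    rw [he, mul_one, ← dist_eq_norm] at h2; linarith)
  have c7 : ∀ a ∈ s, (dist a x) ^ (-(7:ℝ)) = (dist x a)⁻¹ ^ 7 := fun a ha => by
    rw [dist_comm x a, show (-(7:ℝ)) = -((7:ℕ):ℝ) by norm_num, Real.rpow_neg (hpos a ha).le, Real.rpow_natCast, inv_pow]
  have c13 : ∀ a ∈ s, (dist a x) ^ (-(13:ℝ)) = (dist x a)⁻¹ ^ 13 := fun a ha => by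
    rw [dist_comm x a, show (-(13:ℝ)) = -((13:ℕ):ℝ) by norm_num, Real.rpow_neg (hpos a ha).le, Real.rpow_natCast, inv_pow]
  have E : ∀ k m : ℕ, k ≤ m → d ^ ((k:ℝ) - (m:ℝ)) = d⁻¹ ^ (m - k) := fun k m hkm => rpow_natCast_sub_natCast hd0 hkm
  have e34 : d ^ ((3:ℝ) - 7) = d⁻¹ ^ 4 := by simpa using E 3 7 (by norm_num)
  have e25 : d ^ ((2:ℝ) - 7) = d⁻¹ ^ 5 := by simpa using E 2 7 (by norm_num)
  have e16 : d ^ ((1:ℝ) - 7) = d⁻¹ ^ 6 := by simpa using E 1 7 (by norm_num)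
  have e07 : d ^ (-(7:ℝ)) = d⁻¹ ^ 7 := by simpa using E 0 7 (by norm_num)
  have e310 : d ^ ((3:ℝ) - 13) = d⁻¹ ^ 10 := by simpa using E 3 13 (by norm_num)
  have e211 : d ^ ((2:ℝ) - 13) = d⁻¹ ^ 11 := by simpa using E 2 13 (by norm_num)
  have e112 : d ^ ((1:ℝ) - 13) = d⁻¹ ^ 12 := by simpa using E 1 13 (by norm_num)
  have e013 : d ^ (-(13:ℝ)) = d⁻¹ ^ 13 := by simpa using E 0 13 (by norm_num)
  rw [Finset.sum_congr rfl c7, e34, e25, e16, e07] at h7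
  rw [Finset.sum_congr rfl c13, e310, e211, e112, e013] at h13
  have hterm : ∀ a ∈ s, ‖((dist x a)⁻¹ ^ 8 - (dist x a)⁻¹ ^ 14) • (x - a)‖ ≤ (dist x a)⁻¹ ^ 7 + (dist x a)⁻¹ ^ 13 :=
    fun a _ => norm_force_term_le x a
  calc ∑ a ∈ s, ‖((dist x a)⁻¹ ^ 8 - (dist x a)⁻¹ ^ 14) • (x - a)‖
      ≤ ∑ a ∈ s, ((dist x a)⁻¹ ^ 7 + (dist x a)⁻¹ ^ 13) := Finset.sum_le_sum hterm
    _ = ∑ a ∈ s, (dist x a)⁻¹ ^ 7 + ∑ a ∈ s, (dist x a)⁻¹ ^ 13 := Finset.sum_add_distrib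
    _ ≤ _ := by
        have := add_le_add h7 h13
        refine this.trans (le_of_eq ?_)
        norm_num

/-- **Cap-sharp half-space ENERGY column at separation `7/10`** (`p = 6`): `Σ_{a ∈ s} (dist x a)⁻¹^6 ≤ SH6♯(d)`. [folklore] -/
theorem sum_inv_pow_six_le_of_separated_halfspace_sharp_sevenTenths (s : Finset (EuclideanSpace ℝ (Fin 3)))
    (x e : EuclideanSpace ℝ (Fin 3)) (he : ‖e‖ = 1) {d : ℝ} (hd : 7 / 20 ≤ d)
    (hsep : ∀ a ∈ s, ∀ b ∈ s, a ≠ b → (7 : ℝ) / 10 ≤ dist a b) (hhalf : ∀ a ∈ s, d ≤ ⟪a - x, e⟫) :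
    ∑ a ∈ s, (dist x a)⁻¹ ^ 6 ≤
      6 * (4000 / 343 * d⁻¹ ^ 3 / 3 + 2000 / 343 * (63 / 20 - 3 * d) * d⁻¹ ^ 4 / 4 + 600 / 49 * (7 / 10 - d) * d⁻¹ ^ 5 / 5 +
          2000 / 343 * ((7 / 10 - d) ^ 2 * (d + 7 / 20)) * d⁻¹ ^ 6 / 6) := by
  have hd0 : 0 < d := by linarith
  have h6 := sum_rpow_neg_le_of_separated_halfspace_sharp s x e he (p := 6) (by norm_num : (0:ℝ) < 7 / 10) (by linarith) hd0
    (by norm_num) hsep hhalf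
  have hpos : ∀ a ∈ s, 0 < dist a x := fun a ha => hd0.trans_le (by
    have := hhalf a ha; have h2 : ⟪a - x, e⟫ ≤ ‖a - x‖ * ‖e‖ := real_inner_le_norm _ _
    rw [he, mul_one, ← dist_eq_norm] at h2; linarith)
  have c6 : ∀ a ∈ s, (dist a x) ^ (-(6:ℝ)) = (dist x a)⁻¹ ^ 6 := fun a ha => by
    rw [dist_comm x a, show (-(6:ℝ)) = -((6:ℕ):ℝ) by norm_num, Real.rpow_neg (hpos a ha).le, Real.rpow_natCast, inv_pow]
  have E : ∀ k m : ℕ, k ≤ m → d ^ ((k:ℝ) - (m:ℝ)) = d⁻¹ ^ (m - k) := fun k m hkm => rpow_natCast_sub_natCast hd0 hkm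
  have e33 : d ^ ((3:ℝ) - 6) = d⁻¹ ^ 3 := by simpa using E 3 6 (by norm_num)
  have e24 : d ^ ((2:ℝ) - 6) = d⁻¹ ^ 4 := by simpa using E 2 6 (by norm_num)
  have e15 : d ^ ((1:ℝ) - 6) = d⁻¹ ^ 5 := by simpa using E 1 6 (by norm_num)
  have e06 : d ^ (-(6:ℝ)) = d⁻¹ ^ 6 := by simpa using E 0 6 (by norm_num)
  rw [Finset.sum_congr rfl c6, e33, e24, e15, e06] at h6
  refine h6.trans (le_of_eq ?_)
  norm_num

/-- `TH♯(7) ≤ 23/20000 = 1.15·10⁻³` (cylinder version `TH(7) = 2.08·10⁻³`). [folklore] -/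
theorem halfSpaceForceColumnSharp_seven_le :
    7 * (4000 / 343 * (7:ℝ)⁻¹ ^ 4 / 4 + 2000 / 343 * (63 / 20 - 3 * 7) * (7:ℝ)⁻¹ ^ 5 / 5 + 600 / 49 * (7 / 10 - 7) * (7:ℝ)⁻¹ ^ 6 / 6 +
          2000 / 343 * ((7 / 10 - 7) ^ 2 * (7 + 7 / 20)) * (7:ℝ)⁻¹ ^ 7 / 7) +
        13 * (4000 / 343 * (7:ℝ)⁻¹ ^ 10 / 10 + 2000 / 343 * (63 / 20 - 3 * 7) * (7:ℝ)⁻¹ ^ 11 / 11 + 600 / 49 * (7 / 10 - 7) * (7:ℝ)⁻¹ ^ 12 / 12 +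
          2000 / 343 * ((7 / 10 - 7) ^ 2 * (7 + 7 / 20)) * (7:ℝ)⁻¹ ^ 13 / 13) ≤
      23 / 20000 := by
  norm_num

/-- `SH6♯(7) ≤ 3/250 = 1.2·10⁻²` (cylinder version `SH6(7) = 2.15·10⁻²`). [folklore] -/
theorem halfSpaceEnergyColumnSharp_seven_le :
    6 * (4000 / 343 * (7:ℝ)⁻¹ ^ 3 / 3 + 2000 / 343 * (63 / 20 - 3 * 7) * (7:ℝ)⁻¹ ^ 4 / 4 + 600 / 49 * (7 / 10 - 7) * (7:ℝ)⁻¹ ^ 5 / 5 +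
          2000 / 343 * ((7 / 10 - 7) ^ 2 * (7 + 7 / 20)) * (7:ℝ)⁻¹ ^ 6 / 6) ≤
      3 / 250 := by
  norm_num

end Summit.AtomisticToContinuum.Crystallization.Theorems.FrustratedLawDichotomyHalfSpaceCapSharp

end
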